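import Literature.NumberTheory.Sieve.BombieriAsymptoticSieveSmoothPart
import Literature.NumberTheory.Sieve.PolynomialCongruencesRoughAP
import Literature.NumberTheory.Sieve.PolynomialCongruencesMeanValues
import HarnessLib

/-!
# Hooley's theorem on the roots of polynomial congruences — the assembly (PROVED)

Topic `Literature/NumberTheory/Sieve`.  Final layer of the decomposition of the named fact
`Literature.NumberTheory.Sieve.hooley_polyRoots_logPowerSaving` (`PolynomialCongruences.lean`): **Hooley's bound with its
logarithmic saving**, as printed in Dartyge–Martin, *Exponential sums with reducible polynomials*,
Discrete Analysis 2019:15, Lemma 5, case `k = 1` ("The case `k = 1` is [H64]"):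
for `f ∈ ℤ[X]` irreducible of degree `n ≥ 2` and `h ≠ 0`,
`∑_{d ≤ D} S_f(h, d) ≪_{h,f} D (log log D)^{(n²+1)/2} / (log D)^{δ_n}`, `δ_n = (n − √n)/n!`.
The main results are

* `hooley_polyRoots_logPowerSaving_holds : hooley_polyRoots_logPowerSaving` — the discharge of the
  named fact (axioms: `propext`, `Classical.choice`, `Quot.sound`);
* `exists_eventually_sum_norm_polyRootWeylSum_le` — the estimate actually proved, for the sum of
  the absolute values: `∑_{k ≤ D} |S_f(h, k)| ≤ C · D (log log D)^{(n²+1)/2} (log D)^{−δ_n}` for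
  all large `D`.

Relation to `PolynomialCongruencesProofs.lean` (the tree's discharge of the qualitative fact
`hooley_polyRoots_equidistributed`, `∑_{d ≤ D} S_f(h,d) = o(D)`): that file runs the same
`Σ₁`/`Σ₂` architecture with cruder bookkeeping — the rough cofactor is bounded uniformly,
`ρ(b) ≤ C n^{log x/log z}` with `log z = log x/(ε log log x)`, which costs a factor
`(log x)^{ε log n}` and, after the choice `ε = δ/(2 log n)`, leaves the saving
`(log log x)^{δ} (log x)^{−δ/2}` for an unspecified `0 < δ ≤ 1/2` (its
`exists_norm_sum_polyRootWeylSum_le`, `exists_sum_smooth_sqrt_rootCount_div_le`: "only `δ > 0` is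
retained").  The exponents printed in the target (`(log log D)^{(n²+1)/2}` and Hooley's
`δ_n = (n − √n)/n!`) require Hooley's own choices `X = x^{1/log log x}`, the second moment
`Σ₅ = ∑ ρ(k₂)² ≪ (y/log y)(log y/log X)^{n²}` and the Fundamental-Lemma form of Lemma 8 (no
additive `z^{10}` term), which is what is assembled
here from `PolynomialCongruencesMeanValues.lean`, `PolynomialCongruencesRoughAP.lean` and
`PolynomialCongruencesRootDensity.lean`; only the elementary first layer
(`PolynomialCongruencesLemmas.lean`, `PolynomialCongruencesRootCount.lean`, `smoothPart`) is shared.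

## The argument (Hooley 1964, as outlined by Martin–Sitar 2011, §3.2, and Zehavi 2020, §3.2)

With `x = D`, `v = log log x` and `X = x^{1/v}`, factor every `k ≤ x` as `k = k₁ k₂` with `k₁` the
`X`-smooth part (the tree's `smoothPart (⌊X⌋₊ + 1) k`, all prime factors `≤ X`) and `k₂ = k/k₁`
(all prime factors `> X`), and split the sum according to `k₁ ≤ x^{1/3}` (`Σ₁`) or `k₁ > x^{1/3}`
(`Σ₂`).

* `Σ₂` (`exists_sum_norm_polyRootWeylSum_smoothPart_gt_le`, `sum_sigma2_le_at_parameters`):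
  `|S(h,k)| ≤ ρ(k) = ρ(k₁)ρ(k₂)`, `∑_{k₂ ≤ x/k₁} ρ(k₂) ≪ x/k₁` (`exists_sum_rootCount_le`) and Rankin's
  trick for `∑_{k₁ > x^{1/3}, X-smooth} ρ(k₁)/k₁ ≤ x^{−η/3} ∏_{p ≤ X} (…)` with `η = t/log X`,
  `t = 3(A+2)` (`exists_sum_rootCount_smooth_rpow_le`), giving `Σ₂ ≪ x/(log x)²`.
* `Σ₁` (`exists_sum_fiber_norm_polyRootWeylSum_le`, `sum_fiber_le_at_parameters`): for fixed
  `a = k₁`, Hooley's Lemma 1 gives `|S(h, a k₂)| ≤ ρ(k₂) |S(h k̄₂, a)|`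
  (`norm_polyRootWeylSum_le_rootCount_roughPart_mul`); Cauchy–Schwarz over the rough `k₂ ≤ x/a`
  bounds the fibre by `√(Σ₅ Σ₆)` with `Σ₅ = ∑ ρ(k₂)² ≪ (y/log y)(log y/log X)^{n²}`
  (`exists_sum_sq_rootCount_rough_le`) and
  `Σ₆ = ∑_r N(y; a, r)|S(h r̄, a)|² ≤ (max_r N) · (h,a) a ρ(a)` (fibering over `k₂ mod a`,
  `sum_units_norm_sq_polyRootWeylSum_le` and the twisted second moment of
  `PolynomialCongruencesLemmas.lean`), where Hooley's Lemma 8 (`card_rough_congr_le`,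
  `PolynomialCongruencesRoughAP.lean`) gives `max_r N ≪ y/(φ(a) log X)`; summing the resulting
  `x v^{(n²+1)/2}/log x · G(a)`, `G(a) = ((h,a)ρ(a)/(aφ(a)))^{1/2}`, over `a ≤ x^{1/3}` with
  `∑_{a ≤ N} G(a) ≪ (log N)^{1−δ_n}` (`exists_sum_sqrt_gcd_rootCount_div_le`, where the exponent
  `δ_n` enters through `∑_{p ≤ x} √ρ(p)/p ≤ (1 − δ_n) log log x + O(1)` of
  `PolynomialCongruencesRootDensity.lean`) gives `Σ₁ ≪ x v^{(n²+1)/2} (log x)^{−δ_n}`.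

The exponent `(n²+1)/2` of `log log` is Hooley's (from `ρ(p)² ≤ n²` in `Σ₅` and the factor
`1/log X = v/log x` of Lemma 8); all implied constants depend on `f` and `h` only.

## References

* C. Dartyge, G. Martin, *Exponential sums with reducible polynomials*, Discrete Analysis 2019:15,
  Lemma 5. [cite: DartygeMartin2019, Lemma 5]
* C. Hooley, *On the distribution of the roots of polynomial congruences*, Mathematika 11 (1964),
  39–49 (original not held; architecture per the next two items). [cite: Hooley1964, Theorem and Lemmas 1, 7, 8]
* G. Martin, S. Sitar, Mathematika 57 (2011), 1–29, §3.2 "Outline of proof". [cite: MartinSitar2010, §3.2]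
* S. Zehavi, arXiv:2003.13100 (2020), §3.2 "An adaptation of Hooley's argument". [cite: Zehavi2020, §3.2]

## Mathlib

Used: `Finset.sum_fiberwise_of_maps_to`, `Finset.sum_image`, `Finset.sum_mul_sq_le_sq_mul_sq`
(Cauchy–Schwarz), `ZMod.coe_mul_inv_eq_one`, `ZMod.mul_inv_of_unit`, `ZMod.val_injective`,
`Real.tendsto_pow_log_div_mul_add_atTop`, `tendsto_inv_nhdsGT_zero`, `Asymptotics.IsBigO.of_bound`.
-/

noncomputable section

open Finset Real Polynomial Filter Asymptotics
open scoped Nat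

namespace Literature.NumberTheory.Sieve

/-! ### Hooley's factorisation `k = k₁ k₂` via the tree's `Literature.NumberTheory.Sieve.smoothPart`

`k₁ = smoothPart (⌊X⌋₊ + 1) k` is the `X`-smooth part of `k` (prime factors `≤ X`, i.e. `< ⌊X⌋₊ + 1`)
and `k₂ = k / k₁` its `X`-rough cofactor (prime factors `> X`); the API is that of
`BombieriAsymptoticSieveSmoothPart.lean`. -/

/-- The smooth part has all its prime factors `≤ X`. [folklore] -/
theorem forall_primeFactors_smoothPart_le {X : ℝ} (hX : 0 ≤ X) (k : ℕ) :
    ∀ p ∈ (smoothPart (⌊X⌋₊ + 1) k).primeFactors, (p : ℝ) ≤ X := by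
  intro p hp
  have hpB := (Nat.mem_smoothNumbers'.1 (smoothPart_mem_smoothNumbers (⌊X⌋₊ + 1) k)) p
    (Nat.prime_of_mem_primeFactors hp) (Nat.dvd_of_mem_primeFactors hp)
  have : p ≤ ⌊X⌋₊ := Nat.lt_succ_iff.1 hpB
  exact le_trans (by exact_mod_cast this) (Nat.floor_le hX)

/-- The cofactor of the smooth part has all its prime factors `> X`. [folklore] -/
theorem forall_primeFactors_div_smoothPart_gt (X : ℝ) {k : ℕ} (hk : k ≠ 0) :
    ∀ p ∈ (k / smoothPart (⌊X⌋₊ + 1) k).primeFactors, X < (p : ℝ) := by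
  intro p hp
  have hp' := Nat.prime_of_mem_primeFactors hp
  have hpd := Nat.dvd_of_mem_primeFactors hp
  by_contra hle
  have hpB : p < ⌊X⌋₊ + 1 := Nat.lt_succ_iff.2 (Nat.le_floor (not_lt.1 hle))
  exact not_dvd_div_smoothPart hp' hpB hk hpd

/-- The cofactor of the smooth part of `k ≠ 0` is non-zero. [folklore] -/
theorem div_smoothPart_ne_zero (B : ℕ) {k : ℕ} (hk : k ≠ 0) : k / smoothPart B k ≠ 0 :=
  (Nat.div_ne_zero_iff_of_dvd (smoothPart_dvd hk B)).2 ⟨hk, smoothPart_ne_zero B k⟩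

/-- An `X`-smooth and an `X`-rough positive integer are coprime. [folklore] -/
theorem coprime_of_smooth_of_rough {X : ℝ} {a b : ℕ} (ha : ∀ p ∈ a.primeFactors, (p : ℝ) ≤ X)
    (hb : ∀ p ∈ b.primeFactors, X < (p : ℝ)) (ha0 : a ≠ 0) (hb0 : b ≠ 0) : a.Coprime b := by
  rw [← Nat.disjoint_primeFactors ha0 hb0]
  exact Finset.disjoint_left.2 fun p hpa hpb => (lt_irrefl X) ((hb p hpb).trans_le (ha p hpa))

/-- `N / a = ⌊N / a⌋` (natural division versus the floor of the real quotient). [folklore] -/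
theorem nat_div_eq_floor_div (N a : ℕ) : N / a = ⌊(N : ℝ) / a⌋₊ := by
  rw [Nat.floor_div_natCast, Nat.floor_natCast]

/-! ### The twist by the inverse of the rough part (Hooley's Lemma 1 applied to `k = k₁ k₂`) -/

/-- **`|S(h, k)| ≤ ρ(k₂) |S(h k̄₂, k₁)|`** for `k = k₁ k₂` the smooth–rough factorisation
(`k₁ = smoothPart (⌊X⌋₊ + 1) k`, `k₂ = k / k₁`, `k̄₂` the inverse of `k₂` modulo `k₁`): Hooley's
Lemma 1 (`norm_polyRootWeylSum_mul_le`) for the coprime pair `(k₁, k₂)`.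
[cite: Hooley1964, Lemma 1 (per MartinSitar2010 §3.2)] -/
theorem norm_polyRootWeylSum_le_rootCount_roughPart_mul (f : ℤ[X]) (h : ℤ) (X : ℝ) {k : ℕ}
    (hk : k ≠ 0) :
    ‖polyRootWeylSum f k h‖ ≤ (polyRootCountMod ![f] (k / smoothPart (⌊X⌋₊ + 1) k) : ℝ) *
      ‖polyRootWeylSum f (smoothPart (⌊X⌋₊ + 1) k)
        (h * ((((k / smoothPart (⌊X⌋₊ + 1) k : ℕ) :
          ZMod (smoothPart (⌊X⌋₊ + 1) k))⁻¹).val : ℤ))‖ := by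
  have hco : (smoothPart (⌊X⌋₊ + 1) k).Coprime (k / smoothPart (⌊X⌋₊ + 1) k) :=
    coprime_smoothPart_div hk
  haveI : NeZero (smoothPart (⌊X⌋₊ + 1) k) := ⟨smoothPart_ne_zero _ k⟩
  -- `b · (b⁻¹ mod a) ≡ 1 (mod a)` for `(b, a) = 1` (this is `natCast_mul_inv_val_modEq` of the
  -- tree's `PolynomialCongruencesProofs.lean`, restated here to keep the import closure small)
  have he : ∀ {a b : ℕ} [NeZero a], b.Coprime a →
      (b : ℤ) * ((((b : ZMod a)⁻¹).val : ℕ) : ℤ) ≡ 1 [ZMOD a] := by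
    intro a b _ hab
    rw [← ZMod.intCast_eq_intCast_iff]
    push_cast
    rw [ZMod.natCast_zmod_val, ZMod.coe_mul_inv_eq_one b hab]
  replace he := he hco.symm
  have := norm_polyRootWeylSum_mul_le f hco he h
  rw [smoothPart_mul_div hk] at this
  rw [mul_comm]
  exact this

/-- **`∑_{r ∈ U} |S(h r̄, a)|² ≤ (h, a) a ρ(a)`** for any set `U` of units of `ZMod a`: the map
`r ↦ r̄ = r⁻¹` is injective on units, so the sum is part of the twisted second moment
`∑_{c mod a} |S(h c, a)|² ≤ (h, a) a ρ(a)` (`sum_range_norm_sq_polyRootWeylSum_mul_le`).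
[cite: Hooley1964, eq. (9) (per MartinSitar2010 §3.2)] -/
theorem sum_units_norm_sq_polyRootWeylSum_le (f : ℤ[X]) (h : ℤ) (a : ℕ) [NeZero a]
    {U : Finset (ZMod a)} (hU : ∀ r ∈ U, IsUnit r) :
    ∑ r ∈ U, ‖polyRootWeylSum f a (h * (((r⁻¹).val : ℕ) : ℤ))‖ ^ 2 ≤
      (Int.gcd h a : ℝ) * a * polyRootCountMod ![f] a := by
  classical
  have hinj : Set.InjOn (fun r : ZMod a => (r⁻¹).val) ↑U := by
    intro r hr s hs hrs
    have hr' := hU r hr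
    have hs' := hU s hs
    have hrs' : r⁻¹ = s⁻¹ := ZMod.val_injective a hrs
    calc r = r * (s * s⁻¹) := by rw [ZMod.mul_inv_of_unit s hs', mul_one]
      _ = s * (r * r⁻¹) := by rw [hrs']; ring
      _ = s := by rw [ZMod.mul_inv_of_unit r hr', mul_one]
  have himg : U.image (fun r : ZMod a => (r⁻¹).val) ⊆ range a := by
    intro c hc
    obtain ⟨r, -, rfl⟩ := Finset.mem_image.1 hc
    exact mem_range.2 (ZMod.val_lt _)
  calc ∑ r ∈ U, ‖polyRootWeylSum f a (h * (((r⁻¹).val : ℕ) : ℤ))‖ ^ 2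
      = ∑ c ∈ U.image (fun r : ZMod a => (r⁻¹).val), ‖polyRootWeylSum f a (h * (c : ℤ))‖ ^ 2 := by
        rw [Finset.sum_image hinj]
    _ ≤ ∑ c ∈ range a, ‖polyRootWeylSum f a (h * (c : ℤ))‖ ^ 2 :=
        Finset.sum_le_sum_of_subset_of_nonneg himg fun c _ _ => by positivity
    _ ≤ (Int.gcd h a : ℝ) * a * polyRootCountMod ![f] a :=
        sum_range_norm_sq_polyRootWeylSum_mul_le f a h

/-! ### `Σ₁`: the fibre of a fixed smooth part `a` (Cauchy–Schwarz, `Σ₅`, `Σ₆`, Lemma 8) -/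

/-- **Hooley's `θ(y, k₁) ≤ √(Σ₅ Σ₆)`** (Martin–Sitar 2011, §3.2; Zehavi 2020, §3.2).  For `f`
irreducible of degree `n ≥ 1` and an integer `h` there is `C = C(f, h)` such that for `X ≥ 3`, an
`X`-smooth `a ≥ 1`, and `x` with `a² X³ ≤ x`, `N ≤ x`:
`∑_{k ≤ N, k₁ = a} |S_f(h, k)| ≤ C (x/a) ((log(x/a)/log X)^{n²} / (log(x/a) log X))^{1/2} ((h,a) a ρ(a)/φ(a))^{1/2}`.
Proof: `|S(h,k)| ≤ ρ(k₂)|S(h k̄₂, a)|`, Cauchy–Schwarz over the rough `k₂ ≤ x/a`,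
`Σ₅ ≤ C (y/log y)(log y/log X)^{n²}` (`exists_sum_sq_rootCount_rough_le`), and
`Σ₆ = ∑_r N(y; a, r) |S(h r̄, a)|² ≤ (max_r N) (h,a) a ρ(a)` with Lemma 8
(`card_rough_congr_le`) for `max_r N ≤ C y/(φ(a) log X)`, `y = x/a`.
[cite: MartinSitar2010, §3.2 (Σ₁ ≪ Σ_{k₁ ≤ x^{1/3}} √(Σ₅ Σ₆) in Hooley's proof)] -/
theorem exists_sum_fiber_norm_polyRootWeylSum_le {f : ℤ[X]} (hirr : Irreducible f)
    (hdeg : 0 < f.natDegree) (h : ℤ) :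
    ∃ C : ℝ, 0 < C ∧ ∀ (X x : ℝ) (a N : ℕ), 3 ≤ X → 0 < a →
      (∀ p ∈ a.primeFactors, (p : ℝ) ≤ X) → (a : ℝ) ^ 2 * X ^ 3 ≤ x → (N : ℝ) ≤ x →
      ∑ k ∈ (Icc 1 N).filter (fun k => smoothPart (⌊X⌋₊ + 1) k = a), ‖polyRootWeylSum f k h‖ ≤
        C * (x / a) *
          Real.sqrt ((Real.log (x / a) / Real.log X) ^ (f.natDegree ^ 2) /
            (Real.log (x / a) * Real.log X)) *
          Real.sqrt ((Int.gcd h a : ℝ) * a * polyRootCountMod ![f] a / φ a) := by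
  classical
  obtain ⟨C5, hC5, h5⟩ := exists_sum_sq_rootCount_rough_le hirr hdeg
  obtain ⟨C8, hC8, h8⟩ := card_rough_congr_le
  refine ⟨Real.sqrt (C5 * C8), by positivity, fun X x a N hX ha hsm hax hN => ?_⟩
  haveI : NeZero a := ⟨ha.ne'⟩
  set n := f.natDegree with hn
  set y : ℝ := x / a with hy
  have ha1 : (1 : ℝ) ≤ a := by exact_mod_cast ha
  have ha0 : (0 : ℝ) < a := by linarith
  have hX1 : (1 : ℝ) ≤ X := by linarith
  have hX0 : (0 : ℝ) < X := by linarith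
  have hyq : (a : ℝ) * X ^ 3 ≤ y := by
    rw [hy, le_div_iff₀ ha0]; nlinarith
  have hX3 : X ≤ X ^ 3 := le_self_pow₀ hX1 (by norm_num)
  have haX : X ^ 3 ≤ (a : ℝ) * X ^ 3 := le_mul_of_one_le_left (by positivity) ha1
  have hXy : X ≤ y := hX3.trans (haX.trans hyq)
  have hy3 : 3 ≤ y := hX.trans hXy
  have hy0 : 0 < y := by linarith
  have hlogy : 0 < Real.log y := Real.log_pos (by linarith)
  have hlogX : 0 < Real.log X := Real.log_pos (by linarith)
  have hφ0 : (0 : ℝ) < φ a := by exact_mod_cast Nat.totient_pos.2 ha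
  set ρ : ℕ → ℝ := fun m => (polyRootCountMod ![f] m : ℝ) with hρ
  set W : ZMod a → ℝ := fun r => ‖polyRootWeylSum f a (h * (((r⁻¹).val : ℕ) : ℤ))‖ with hW
  have hW0 : ∀ r, 0 ≤ W r := fun r => norm_nonneg _
  set R := (Icc 1 ⌊y⌋₊).filter (fun b : ℕ => ∀ p ∈ b.primeFactors, X < (p : ℝ)) with hR
  set Fib := (Icc 1 N).filter (fun k => smoothPart (⌊X⌋₊ + 1) k = a) with hFib
  -- Step 1: reindex the fibre by the rough part
  have step1 : ∑ k ∈ Fib, ‖polyRootWeylSum f k h‖ ≤ ∑ b ∈ R, ρ b * W (b : ZMod a) := by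
    have hterm : ∀ k ∈ Fib, ‖polyRootWeylSum f k h‖ ≤
        ρ ((k / smoothPart (⌊X⌋₊ + 1) k)) * W ((k / smoothPart (⌊X⌋₊ + 1) k : ℕ) : ZMod a) := by
      intro k hk
      rw [hFib, Finset.mem_filter, Finset.mem_Icc] at hk
      have hk0 : k ≠ 0 := by omega
      have := norm_polyRootWeylSum_le_rootCount_roughPart_mul f h X hk0
      rw [hk.2] at this ⊢
      exact this
    have hinj : Set.InjOn (fun k : ℕ => k / smoothPart (⌊X⌋₊ + 1) k) ↑Fib := by
      intro k hk k' hk' hkk'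
      rw [Finset.mem_coe, hFib, Finset.mem_filter, Finset.mem_Icc] at hk hk'
      have e1 := smoothPart_mul_div (show k ≠ 0 by omega) (⌊X⌋₊ + 1)
      have e2 := smoothPart_mul_div (show k' ≠ 0 by omega) (⌊X⌋₊ + 1)
      dsimp only at hkk'
      rw [← e1, ← e2, hkk', hk.2, hk'.2]
    have himg : Fib.image (fun k : ℕ => k / smoothPart (⌊X⌋₊ + 1) k) ⊆ R := by
      intro b hb
      obtain ⟨k, hk, rfl⟩ := Finset.mem_image.1 hb
      rw [hFib, Finset.mem_filter, Finset.mem_Icc] at hk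
      have hk0 : k ≠ 0 := by omega
      rw [hR, Finset.mem_filter, Finset.mem_Icc]
      refine ⟨⟨Nat.pos_of_ne_zero (div_smoothPart_ne_zero (⌊X⌋₊ + 1) hk0), ?_⟩,
        forall_primeFactors_div_smoothPart_gt X hk0⟩
      have h1 : (k / smoothPart (⌊X⌋₊ + 1) k) ≤ N / a := hk.2 ▸ Nat.div_le_div_right hk.1.2
      refine h1.trans ?_
      rw [nat_div_eq_floor_div, hy]
      exact Nat.floor_mono (div_le_div_of_nonneg_right hN ha0.le)
    calc ∑ k ∈ Fib, ‖polyRootWeylSum f k h‖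
        ≤ ∑ k ∈ Fib, ρ ((k / smoothPart (⌊X⌋₊ + 1) k)) * W ((k / smoothPart (⌊X⌋₊ + 1) k : ℕ) : ZMod a) :=
          Finset.sum_le_sum hterm
      _ = ∑ b ∈ Fib.image (fun k : ℕ => k / smoothPart (⌊X⌋₊ + 1) k), ρ b * W (b : ZMod a) :=
          (Finset.sum_image (f := fun b => ρ b * W (b : ZMod a)) hinj).symm
      _ ≤ ∑ b ∈ R, ρ b * W (b : ZMod a) :=
          Finset.sum_le_sum_of_subset_of_nonneg himg fun b _ _ =>
            mul_nonneg (Nat.cast_nonneg _) (hW0 _)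
  -- Step 2: Cauchy–Schwarz
  have step2 := Finset.sum_mul_sq_le_sq_mul_sq R (fun b => ρ b) (fun b => W (b : ZMod a))
  -- Step 3: `Σ₅`
  have step3 : ∑ b ∈ R, ρ b ^ 2 ≤ C5 * (y / Real.log y) * (Real.log y / Real.log X) ^ (n ^ 2) :=
    h5 X y (by linarith) hXy
  -- Step 4: `Σ₆` by fibering over the residue of `b` modulo `a`, and Lemma 8
  have hNmax : ∀ r : ZMod a, IsUnit r →
      (#(R.filter (fun b : ℕ => (b : ZMod a) = r)) : ℝ) ≤ C8 * y / ((φ a : ℝ) * Real.log X) := by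
    intro r hr
    have hcop : (r.val).Coprime a := by
      rw [← ZMod.isUnit_iff_coprime, ZMod.natCast_zmod_val]; exact hr
    refine h8 a r.val ha hcop X y hX hyq _ fun b hb => ?_
    rw [Finset.mem_filter, hR, Finset.mem_filter, Finset.mem_Icc] at hb
    obtain ⟨⟨⟨hb1, hby⟩, hbr⟩, hbr'⟩ := hb
    refine ⟨by omega, ?_, ?_, fun p hp hpb => hbr p (Nat.mem_primeFactors.2 ⟨hp, hpb, by omega⟩)⟩
    · exact le_trans (by exact_mod_cast hby) (Nat.floor_le hy0.le)
    · rw [← ZMod.natCast_eq_natCast_iff, ZMod.natCast_zmod_val]; exact hbr'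
  have hunit : ∀ b ∈ R, IsUnit ((b : ℕ) : ZMod a) := by
    intro b hb
    rw [hR, Finset.mem_filter, Finset.mem_Icc] at hb
    rw [ZMod.isUnit_iff_coprime]
    exact (coprime_of_smooth_of_rough hsm hb.2 ha.ne' (by omega)).symm
  have step4 : ∑ b ∈ R, W (b : ZMod a) ^ 2 ≤
      C8 * y / ((φ a : ℝ) * Real.log X) * ((Int.gcd h a : ℝ) * a * ρ a) := by
    have hfib : ∑ b ∈ R, W (b : ZMod a) ^ 2 =
        ∑ r : ZMod a, W r ^ 2 * #(R.filter (fun b : ℕ => (b : ZMod a) = r)) := by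
      rw [← Finset.sum_fiberwise_of_maps_to (g := fun b : ℕ => (b : ZMod a))
        (fun _ _ => Finset.mem_univ _) (fun b : ℕ => W (b : ZMod a) ^ 2)]
      refine Finset.sum_congr rfl fun r _ => ?_
      have : ∑ b ∈ R.filter (fun b : ℕ => (b : ZMod a) = r), W (b : ZMod a) ^ 2 =
          ∑ b ∈ R.filter (fun b : ℕ => (b : ZMod a) = r), W r ^ 2 :=
        Finset.sum_congr rfl fun b hb => by rw [(Finset.mem_filter.1 hb).2]
      rw [this, Finset.sum_const, nsmul_eq_mul, mul_comm]
    rw [hfib]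
    have hK0 : 0 ≤ C8 * y / ((φ a : ℝ) * Real.log X) := by positivity
    calc ∑ r : ZMod a, W r ^ 2 * #(R.filter (fun b : ℕ => (b : ZMod a) = r))
        ≤ ∑ r : ZMod a, if IsUnit r then W r ^ 2 * (C8 * y / ((φ a : ℝ) * Real.log X)) else 0 := by
          refine Finset.sum_le_sum fun r _ => ?_
          split_ifs with hr
          · exact mul_le_mul_of_nonneg_left (hNmax r hr) (sq_nonneg _)
          · have hempty : R.filter (fun b : ℕ => (b : ZMod a) = r) = ∅ :=
              Finset.filter_eq_empty_iff.2 fun b hb hbr => hr (hbr ▸ hunit b hb)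
            rw [hempty, Finset.card_empty, Nat.cast_zero, mul_zero]
      _ = C8 * y / ((φ a : ℝ) * Real.log X) *
            ∑ r ∈ (univ : Finset (ZMod a)).filter (fun r => IsUnit r), W r ^ 2 := by
          rw [← Finset.sum_filter, Finset.mul_sum]
          exact Finset.sum_congr rfl fun r _ => by ring
      _ ≤ C8 * y / ((φ a : ℝ) * Real.log X) * ((Int.gcd h a : ℝ) * a * ρ a) :=
          mul_le_mul_of_nonneg_left
            (sum_units_norm_sq_polyRootWeylSum_le f h a fun r hr => (Finset.mem_filter.1 hr).2) hK0
  -- Step 5: combine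
  have hρ20 : 0 ≤ ∑ b ∈ R, ρ b ^ 2 := Finset.sum_nonneg fun b _ => sq_nonneg _
  have h50 : 0 ≤ C5 * (y / Real.log y) * (Real.log y / Real.log X) ^ (n ^ 2) :=
    mul_nonneg (mul_nonneg hC5.le (div_nonneg hy0.le hlogy.le))
      (pow_nonneg (div_nonneg hlogy.le hlogX.le) _)
  have hlogy' : Real.log y ≠ 0 := hlogy.ne'
  have hlogX' : Real.log X ≠ 0 := hlogX.ne'
  have hφ' : (φ a : ℝ) ≠ 0 := hφ0.ne'
  have hprod : (∑ b ∈ R, ρ b * W (b : ZMod a)) ^ 2 ≤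
      (C5 * C8) * (y ^ 2 * (((Real.log y / Real.log X) ^ (n ^ 2) / (Real.log y * Real.log X)) *
        ((Int.gcd h a : ℝ) * a * ρ a / φ a))) := by
    calc (∑ b ∈ R, ρ b * W (b : ZMod a)) ^ 2
        ≤ (∑ b ∈ R, ρ b ^ 2) * ∑ b ∈ R, W (b : ZMod a) ^ 2 := step2
      _ ≤ (C5 * (y / Real.log y) * (Real.log y / Real.log X) ^ (n ^ 2)) *
            (C8 * y / ((φ a : ℝ) * Real.log X) * ((Int.gcd h a : ℝ) * a * ρ a)) :=
          mul_le_mul step3 step4 (Finset.sum_nonneg fun b _ => sq_nonneg _) h50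
      _ = (C5 * C8) * (y ^ 2 * (((Real.log y / Real.log X) ^ (n ^ 2) / (Real.log y * Real.log X)) *
            ((Int.gcd h a : ℝ) * a * ρ a / φ a))) := by
          field_simp
  set Q : ℝ := (Real.log y / Real.log X) ^ (n ^ 2) / (Real.log y * Real.log X) with hQdef
  set Gg : ℝ := (Int.gcd h a : ℝ) * a * ρ a / φ a with hGgdef
  have hQ0 : 0 ≤ Q :=
    div_nonneg (pow_nonneg (div_nonneg hlogy.le hlogX.le) _) (mul_nonneg hlogy.le hlogX.le)
  have hsqrt : Real.sqrt ((C5 * C8) * (y ^ 2 * (Q * Gg))) =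
      Real.sqrt (C5 * C8) * y * Real.sqrt Q * Real.sqrt Gg := by
    rw [Real.sqrt_mul (mul_nonneg hC5.le hC8.le), Real.sqrt_mul (sq_nonneg y), Real.sqrt_mul hQ0,
      Real.sqrt_sq hy0.le]
    ring
  calc ∑ k ∈ Fib, ‖polyRootWeylSum f k h‖ ≤ ∑ b ∈ R, ρ b * W (b : ZMod a) := step1
    _ ≤ Real.sqrt ((C5 * C8) * (y ^ 2 * (Q * Gg))) := Real.le_sqrt_of_sq_le hprod
    _ = Real.sqrt (C5 * C8) * y * Real.sqrt Q * Real.sqrt Gg := hsqrt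

/-! ### `Σ₂`: the terms with a large smooth part (Rankin's trick) -/

/-- **Hooley's `Σ₂`** (Martin–Sitar 2011, §3.2: "`Σ₂ ≪ ∑_{k ≤ x, k₁ > x^{1/3}} ρ(k)` … `≪ x/log x`";
Zehavi 2020, §3.2).  For `f` irreducible of positive degree there is `A ∈ ℕ` such that for every
`t ≥ 0` there is `C` with: for all `N`, `X ≥ 2` with `3t ≤ log X`, and `Y ≥ 1`,
`∑_{k ≤ N, k₁ > Y} |S_f(h, k)| ≤ C N Y^{−t/log X} (log X)^A`
(`|S(h,k)| ≤ ρ(k) = ρ(k₁)ρ(k₂)`, `∑_{k₂ ≤ N/k₁} ρ(k₂) ≤ C N/k₁` by `exists_sum_rootCount_le`,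
and Rankin's trick `exists_sum_rootCount_smooth_rpow_le` for `∑_{k₁ > Y} ρ(k₁)/k₁`).
[cite: MartinSitar2010, §3.2 (Σ₂ ≪ Σ_{k ≤ x, k₁ > x^{1/3}} ρ(k) ≪ x/log x in Hooley's proof; his Lemma 7)] -/
theorem exists_sum_norm_polyRootWeylSum_smoothPart_gt_le {f : ℤ[X]} (hirr : Irreducible f)
    (hdeg : 0 < f.natDegree) (h : ℤ) :
    ∃ A : ℕ, ∀ t : ℝ, 0 ≤ t → ∃ C : ℝ, 0 < C ∧ ∀ (N : ℕ) (X Y : ℝ), 2 ≤ X →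
      3 * t ≤ Real.log X → 1 ≤ Y →
      ∑ k ∈ (Icc 1 N).filter (fun k => Y < (smoothPart (⌊X⌋₊ + 1) k : ℝ)), ‖polyRootWeylSum f k h‖ ≤
        C * N * Y ^ (-(t / Real.log X)) * Real.log X ^ A := by
  classical
  obtain ⟨Cρ, hCρ, hρsum⟩ := exists_sum_rootCount_le hirr hdeg
  obtain ⟨A, hA⟩ := exists_sum_rootCount_smooth_rpow_le hirr hdeg
  refine ⟨A, fun t ht => ?_⟩
  obtain ⟨C7, hC7, h7⟩ := hA t ht
  refine ⟨max Cρ 1 * C7, by positivity, fun N X Y hX htX hY => ?_⟩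
  set ρ : ℕ → ℝ := fun m => (polyRootCountMod ![f] m : ℝ) with hρ
  set η : ℝ := t / Real.log X with hη
  have hlogX : 0 < Real.log X := Real.log_pos (by linarith)
  have hη0 : 0 ≤ η := div_nonneg ht hlogX.le
  have hY0 : 0 < Y := by linarith
  set K₂ := (Icc 1 N).filter (fun k => Y < (smoothPart (⌊X⌋₊ + 1) k : ℝ)) with hK₂
  set SA := (Icc 1 N).filter (fun a : ℕ => (∀ p ∈ a.primeFactors, (p : ℝ) ≤ X) ∧ Y < (a : ℝ))
    with hSA
  -- Step 1: `|S(h,k)| ≤ ρ(k₁) ρ(k₂)`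
  have hterm : ∀ k ∈ K₂, ‖polyRootWeylSum f k h‖ ≤
      ρ (smoothPart (⌊X⌋₊ + 1) k) * ρ ((k / smoothPart (⌊X⌋₊ + 1) k)) := by
    intro k hk
    rw [hK₂, Finset.mem_filter, Finset.mem_Icc] at hk
    have hk0 : k ≠ 0 := by omega
    calc ‖polyRootWeylSum f k h‖ ≤ ρ k := norm_polyRootWeylSum_le f k h
      _ = ρ (smoothPart (⌊X⌋₊ + 1) k) * ρ ((k / smoothPart (⌊X⌋₊ + 1) k)) := by
          simp only [hρ]
          rw [← Nat.cast_mul, ← polyRootCountMod_mul_of_coprime f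
            (coprime_smoothPart_div hk0), smoothPart_mul_div hk0 (⌊X⌋₊ + 1)]
  -- Step 2: fibre over `a = k₁`
  have hmaps : ∀ k ∈ K₂, smoothPart (⌊X⌋₊ + 1) k ∈ SA := by
    intro k hk
    rw [hK₂, Finset.mem_filter, Finset.mem_Icc] at hk
    have hk0 : k ≠ 0 := by omega
    rw [hSA, Finset.mem_filter, Finset.mem_Icc]
    refine ⟨⟨Nat.pos_of_ne_zero (smoothPart_ne_zero (⌊X⌋₊ + 1) k), ?_⟩,
      forall_primeFactors_smoothPart_le (by linarith) k, hk.2⟩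
    exact le_trans (Nat.le_of_dvd (by omega) (smoothPart_dvd hk0 (⌊X⌋₊ + 1))) hk.1.2
  have hinner : ∀ a ∈ SA, ∑ k ∈ K₂.filter (fun k => smoothPart (⌊X⌋₊ + 1) k = a),
      ρ ((k / smoothPart (⌊X⌋₊ + 1) k)) ≤ max Cρ 1 * ((N : ℝ) / a) := by
    intro a haSA
    rw [hSA, Finset.mem_filter, Finset.mem_Icc] at haSA
    have ha : 0 < a := haSA.1.1
    have ha0 : (0 : ℝ) < a := by exact_mod_cast ha
    have hinj : Set.InjOn (fun k : ℕ => k / smoothPart (⌊X⌋₊ + 1) k) ↑(K₂.filter (fun k => smoothPart (⌊X⌋₊ + 1) k = a)) := by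
      intro k hk k' hk' hkk'
      rw [Finset.mem_coe, Finset.mem_filter, hK₂, Finset.mem_filter, Finset.mem_Icc] at hk hk'
      have e1 := smoothPart_mul_div (show k ≠ 0 by omega) (⌊X⌋₊ + 1)
      have e2 := smoothPart_mul_div (show k' ≠ 0 by omega) (⌊X⌋₊ + 1)
      dsimp only at hkk'
      rw [← e1, ← e2, hkk', hk.2, hk'.2]
    have himg : (K₂.filter (fun k => smoothPart (⌊X⌋₊ + 1) k = a)).image (fun k : ℕ => k / smoothPart (⌊X⌋₊ + 1) k) ⊆
        Icc 1 (N / a) := by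
      intro b hb
      obtain ⟨k, hk, rfl⟩ := Finset.mem_image.1 hb
      rw [Finset.mem_filter, hK₂, Finset.mem_filter, Finset.mem_Icc] at hk
      rw [Finset.mem_Icc]
      exact ⟨Nat.pos_of_ne_zero (div_smoothPart_ne_zero (⌊X⌋₊ + 1) (show k ≠ 0 by omega)),
        hk.2 ▸ Nat.div_le_div_right hk.1.1.2⟩
    have hsum : ∑ b ∈ Icc 1 (N / a), ρ b ≤ max Cρ 1 * ((N : ℝ) / a) := by
      have hfl : N / a = ⌊(N : ℝ) / a⌋₊ := nat_div_eq_floor_div N a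
      rcases le_or_gt 2 ((N : ℝ) / a) with h2 | h2
      · calc ∑ b ∈ Icc 1 (N / a), ρ b = ∑ b ∈ Icc 1 ⌊(N : ℝ) / a⌋₊, ρ b := by rw [hfl]
          _ ≤ Cρ * ((N : ℝ) / a) := hρsum _ h2
          _ ≤ max Cρ 1 * ((N : ℝ) / a) :=
              mul_le_mul_of_nonneg_right (le_max_left _ _) (by positivity)
      · have hNa : N / a ≤ 1 := by
          rw [hfl]
          have : ⌊(N : ℝ) / a⌋₊ < 2 := (Nat.floor_lt (by positivity)).2 (by exact_mod_cast h2)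
          omega
        have h1 : (1 : ℝ) ≤ (N : ℝ) / a := by
          rw [le_div_iff₀ ha0, one_mul]; exact_mod_cast haSA.1.2
        calc ∑ b ∈ Icc 1 (N / a), ρ b ≤ ∑ b ∈ Icc 1 1, ρ b :=
              Finset.sum_le_sum_of_subset_of_nonneg (Finset.Icc_subset_Icc_right hNa)
                fun _ _ _ => Nat.cast_nonneg _
          _ = 1 := by
            simp [hρ, (show polyRootCountMod ![f] 1 = 1 by rw [polyRootCountMod_single]; simp)]
          _ ≤ max Cρ 1 * ((N : ℝ) / a) := by nlinarith [le_max_right Cρ 1]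
    calc ∑ k ∈ K₂.filter (fun k => smoothPart (⌊X⌋₊ + 1) k = a), ρ ((k / smoothPart (⌊X⌋₊ + 1) k))
        = ∑ b ∈ (K₂.filter (fun k => smoothPart (⌊X⌋₊ + 1) k = a)).image (fun k : ℕ => k / smoothPart (⌊X⌋₊ + 1) k), ρ b :=
          (Finset.sum_image hinj).symm
      _ ≤ ∑ b ∈ Icc 1 (N / a), ρ b :=
          Finset.sum_le_sum_of_subset_of_nonneg himg fun _ _ _ => Nat.cast_nonneg _
      _ ≤ _ := hsum
  -- Step 3: sum over the fibres
  have step3 : ∑ k ∈ K₂, ‖polyRootWeylSum f k h‖ ≤ max Cρ 1 * N * ∑ a ∈ SA, ρ a / a := by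
    calc ∑ k ∈ K₂, ‖polyRootWeylSum f k h‖
        ≤ ∑ k ∈ K₂, ρ (smoothPart (⌊X⌋₊ + 1) k) * ρ ((k / smoothPart (⌊X⌋₊ + 1) k)) := Finset.sum_le_sum hterm
      _ = ∑ a ∈ SA, ∑ k ∈ K₂.filter (fun k => smoothPart (⌊X⌋₊ + 1) k = a),
            ρ (smoothPart (⌊X⌋₊ + 1) k) * ρ ((k / smoothPart (⌊X⌋₊ + 1) k)) :=
          (Finset.sum_fiberwise_of_maps_to hmaps _).symm
      _ = ∑ a ∈ SA, ρ a * ∑ k ∈ K₂.filter (fun k => smoothPart (⌊X⌋₊ + 1) k = a),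
            ρ ((k / smoothPart (⌊X⌋₊ + 1) k)) := by
          refine Finset.sum_congr rfl fun a _ => ?_
          rw [Finset.mul_sum]
          exact Finset.sum_congr rfl fun k hk => by rw [(Finset.mem_filter.1 hk).2]
      _ ≤ ∑ a ∈ SA, ρ a * (max Cρ 1 * ((N : ℝ) / a)) :=
          Finset.sum_le_sum fun a ha => mul_le_mul_of_nonneg_left (hinner a ha) (Nat.cast_nonneg _)
      _ = max Cρ 1 * N * ∑ a ∈ SA, ρ a / a := by
          rw [Finset.mul_sum]
          exact Finset.sum_congr rfl fun a _ => by ring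
  -- Step 4: Rankin
  have step4 : ∑ a ∈ SA, ρ a / a ≤ Y ^ (-η) * (C7 * Real.log X ^ A) := by
    have hpt : ∀ a ∈ SA, ρ a / a ≤ Y ^ (-η) * (ρ a * (a : ℝ) ^ (η - 1)) := by
      intro a ha
      rw [hSA, Finset.mem_filter, Finset.mem_Icc] at ha
      have ha0 : (0 : ℝ) < a := by exact_mod_cast ha.1.1
      have hYa : Y < a := ha.2.2
      have haη : (0 : ℝ) < (a : ℝ) ^ η := Real.rpow_pos_of_pos ha0 η
      have e1 : ρ a / a = (a : ℝ) ^ (-η) * (ρ a * (a : ℝ) ^ (η - 1)) := by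
        rw [Real.rpow_sub_one ha0.ne', Real.rpow_neg ha0.le]
        field_simp
      rw [e1]
      refine mul_le_mul_of_nonneg_right ?_ (by positivity)
      exact Real.rpow_le_rpow_of_nonpos hY0 hYa.le (by linarith)
    have hsub : SA ⊆ (Icc 1 N).filter (fun k : ℕ => ∀ p ∈ k.primeFactors, (p : ℝ) ≤ X) := by
      intro a ha
      rw [hSA, Finset.mem_filter] at ha
      exact Finset.mem_filter.2 ⟨ha.1, ha.2.1⟩
    calc ∑ a ∈ SA, ρ a / a ≤ ∑ a ∈ SA, Y ^ (-η) * (ρ a * (a : ℝ) ^ (η - 1)) :=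
          Finset.sum_le_sum hpt
      _ = Y ^ (-η) * ∑ a ∈ SA, ρ a * (a : ℝ) ^ (η - 1) := by rw [Finset.mul_sum]
      _ ≤ Y ^ (-η) * ∑ a ∈ (Icc 1 N).filter (fun k : ℕ => ∀ p ∈ k.primeFactors, (p : ℝ) ≤ X),
            ρ a * (a : ℝ) ^ (η - 1) :=
          mul_le_mul_of_nonneg_left
            (Finset.sum_le_sum_of_subset_of_nonneg hsub fun a _ _ => by positivity) (by positivity)
      _ ≤ Y ^ (-η) * (C7 * Real.log X ^ A) :=
          mul_le_mul_of_nonneg_left (h7 X hX htX N) (by positivity)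
  calc ∑ k ∈ K₂, ‖polyRootWeylSum f k h‖ ≤ max Cρ 1 * N * ∑ a ∈ SA, ρ a / a := step3
    _ ≤ max Cρ 1 * N * (Y ^ (-η) * (C7 * Real.log X ^ A)) :=
        mul_le_mul_of_nonneg_left step4 (by positivity)
    _ = max Cρ 1 * C7 * N * Y ^ (-η) * Real.log X ^ A := by ring

/-! ### Assembly: auxiliary real inequalities (kept outside the main proof) -/

/-- `log x / log log x → ∞`. [folklore] -/
theorem tendsto_log_div_loglog_atTop :
    Tendsto (fun x : ℝ => Real.log x / Real.log (Real.log x)) atTop atTop := by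
  have h1 : Tendsto (fun u : ℝ => Real.log u / u) atTop (nhds 0) := by
    simpa using Real.tendsto_pow_log_div_mul_add_atTop 1 0 1 one_ne_zero
  have h2 : Tendsto (fun u : ℝ => Real.log u / u) atTop (nhdsWithin 0 (Set.Ioi 0)) := by
    refine tendsto_nhdsWithin_iff.2 ⟨h1, ?_⟩
    filter_upwards [eventually_gt_atTop 1] with u hu
    exact div_pos (Real.log_pos hu) (by linarith)
  have h3 : Tendsto (fun u : ℝ => u / Real.log u) atTop atTop := by
    refine (tendsto_inv_nhdsGT_zero.comp h2).congr' ?_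
    filter_upwards with u
    simp [Function.comp, inv_div]
  exact h3.comp Real.tendsto_log_atTop

/-- `δ_n ≤ 1`. [folklore] -/
theorem hooleyDelta_le_one (n : ℕ) : hooleyDelta n ≤ 1 := by
  rw [hooleyDelta_def, div_le_one (by exact_mod_cast Nat.factorial_pos n)]
  have h1 : (n : ℝ) ≤ (n.factorial : ℝ) := by exact_mod_cast Nat.self_le_factorial n
  linarith [Real.sqrt_nonneg (n : ℝ)]

/-- `√(v^m) = v^{m/2}`. [folklore] -/
theorem sqrt_pow_eq_rpow {v : ℝ} (hv : 0 ≤ v) (m : ℕ) :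
    Real.sqrt (v ^ m) = v ^ ((m : ℝ) / 2) := by
  rw [Real.sqrt_eq_rpow, ← Real.rpow_natCast, ← Real.rpow_mul hv]
  congr 1
  ring

/-- The logarithmic factor of `√(Σ₅ Σ₆)`: with `log X = log x / v`, `(2/3) log x ≤ log y ≤ log x`,
`((log y/log X)^m / (log y log X))^{1/2} ≤ (3/2)^{1/2} v^{(m+1)/2} / log x`. [folklore] -/
theorem sqrt_logFactor_le {La LX Lx v : ℝ} (m : ℕ) (hv : 0 < v) (hLx : 0 < Lx)
    (hLX : LX = Lx / v) (hge : 2 / 3 * Lx ≤ La) (hle : La ≤ Lx) :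
    Real.sqrt ((La / LX) ^ m / (La * LX)) ≤ Real.sqrt (3 / 2) * (v ^ (((m : ℝ) + 1) / 2) / Lx) := by
  have hLXpos : 0 < LX := by rw [hLX]; positivity
  have hLa : 0 < La := by linarith
  have hvq : Lx / LX = v := by rw [hLX]; field_simp
  have hQ : (La / LX) ^ m / (La * LX) ≤ 3 / 2 * v ^ (m + 1) / Lx ^ 2 := by
    have hnum : (La / LX) ^ m ≤ v ^ m := by
      rw [← hvq]
      exact pow_le_pow_left₀ (div_nonneg hLa.le hLXpos.le) (div_le_div_of_nonneg_right hle hLXpos.le) m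
    have hden : 2 / 3 * Lx * LX ≤ La * LX := mul_le_mul_of_nonneg_right hge hLXpos.le
    have hden0 : 0 < 2 / 3 * Lx * LX := by positivity
    calc (La / LX) ^ m / (La * LX) ≤ v ^ m / (2 / 3 * Lx * LX) :=
          div_le_div₀ (by positivity) hnum hden0 hden
      _ = 3 / 2 * v ^ (m + 1) / Lx ^ 2 := by
          rw [hLX]; field_simp; ring
  refine (Real.sqrt_le_sqrt hQ).trans (le_of_eq ?_)
  rw [Real.sqrt_div' _ (sq_nonneg _), Real.sqrt_sq hLx.le, Real.sqrt_mul' _ (pow_nonneg hv.le _),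
    sqrt_pow_eq_rpow hv.le (m + 1)]
  push_cast
  ring

/-- `(x/a) · ((h,a) a ρ(a)/φ(a))^{1/2} = x · ((h,a) ρ(a)/(a φ(a)))^{1/2}`. [folklore] -/
theorem div_mul_sqrt_eq {x a g r q : ℝ} (ha : 0 < a) (hq : 0 < q) :
    x / a * Real.sqrt (g * a * r / q) = x * Real.sqrt (g * r / (a * q)) := by
  have e1 : g * a * r / q = a ^ 2 * (g * r / (a * q)) := by field_simp
  rw [e1, Real.sqrt_mul (sq_nonneg a), Real.sqrt_sq ha.le]
  field_simp

/-- The final bookkeeping identity of `Σ₁`. [folklore] -/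
theorem sigma1_identity {x s w L c C δ : ℝ} (hL : 0 < L) :
    C * x * (s * (w / L)) * (c * L ^ (1 - δ)) = C * c * s * (x * w / L ^ δ) := by
  rw [Real.rpow_sub hL, Real.rpow_one]
  field_simp

/-- `x/(log x)² ≤ x v^e/(log x)^δ` for `log x ≥ 1`, `v^e ≥ 1`, `δ ≤ 2`. [folklore] -/
theorem div_sq_le_mul_div_rpow {x L w δ : ℝ} (hx : 0 ≤ x) (hL : 1 ≤ L) (hw : 1 ≤ w) (hδ : δ ≤ 2) :
    x / L ^ 2 ≤ x * w / L ^ δ := by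
  have hL0 : 0 < L := by linarith
  rw [div_le_div_iff₀ (by positivity) (Real.rpow_pos_of_pos hL0 δ)]
  have h1 : L ^ δ ≤ L ^ (2 : ℝ) := Real.rpow_le_rpow_of_exponent_le hL hδ
  have h2 : L ^ (2 : ℝ) = L ^ 2 := by norm_cast
  calc x * L ^ δ ≤ x * L ^ 2 := by rw [← h2]; exact mul_le_mul_of_nonneg_left h1 hx
    _ ≤ x * w * L ^ 2 := by
        have : 0 ≤ x * L ^ 2 := by positivity
        nlinarith

/-! ### Assembly: the fibre bound and `Σ₂` at Hooley's parameters -/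

/-- The bound for one fibre of `Σ₁` at Hooley's parameters (`X = x^{1/v}`, `Y = x^{1/3}`):
`∑_{k ≤ D, k₁ = a} |S(h,k)| ≤ C₁ x (3/2)^{1/2} v^{(n²+1)/2}/log x · G(a)` for `1 ≤ a ≤ Y`.
[folklore] -/
theorem sum_fiber_le_at_parameters {f : ℤ[X]} {h : ℤ} {C1 : ℝ} (hC1 : 0 ≤ C1)
    (h1 : ∀ (X x : ℝ) (a N : ℕ), 3 ≤ X → 0 < a → (∀ p ∈ a.primeFactors, (p : ℝ) ≤ X) →
      (a : ℝ) ^ 2 * X ^ 3 ≤ x → (N : ℝ) ≤ x →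
      ∑ k ∈ (Icc 1 N).filter (fun k => smoothPart (⌊X⌋₊ + 1) k = a), ‖polyRootWeylSum f k h‖ ≤
        C1 * (x / a) *
          Real.sqrt ((Real.log (x / a) / Real.log X) ^ (f.natDegree ^ 2) /
            (Real.log (x / a) * Real.log X)) *
          Real.sqrt ((Int.gcd h a : ℝ) * a * polyRootCountMod ![f] a / φ a))
    {X x Y v : ℝ} {D a : ℕ} (hX : 3 ≤ X) (hx : 0 < x) (hlogx : 0 < Real.log x) (hv : 0 < v)
    (hlogX : Real.log X = Real.log x / v) (hY : 0 < Y) (hlogY : Real.log Y = Real.log x / 3)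
    (hX3Y : X ^ 3 ≤ Y) (hY3 : Y ^ 3 = x) (hDx : (D : ℝ) ≤ x) (ha : 0 < a) (haY : (a : ℝ) ≤ Y) :
    ∑ k ∈ (Icc 1 D).filter (fun k => smoothPart (⌊X⌋₊ + 1) k = a), ‖polyRootWeylSum f k h‖ ≤
      C1 * x * (Real.sqrt (3 / 2) * (v ^ ((((f.natDegree ^ 2 : ℕ) : ℝ) + 1) / 2) / Real.log x)) *
        Real.sqrt ((Int.gcd h a : ℝ) * polyRootCountMod ![f] a / ((a : ℝ) * φ a)) := by
  have ha0 : (0 : ℝ) < a := by exact_mod_cast ha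
  have ha1 : (1 : ℝ) ≤ a := by exact_mod_cast ha
  have hφ0 : (0 : ℝ) < φ a := by exact_mod_cast Nat.totient_pos.2 ha
  by_cases hsm : ∀ p ∈ a.primeFactors, (p : ℝ) ≤ X
  · have hax : (a : ℝ) ^ 2 * X ^ 3 ≤ x := by
      calc (a : ℝ) ^ 2 * X ^ 3 ≤ Y ^ 2 * Y :=
            mul_le_mul (pow_le_pow_left₀ ha0.le haY 2) hX3Y (by positivity) (by positivity)
        _ = Y ^ 3 := by ring
        _ = x := hY3
    have hin := h1 X x a D hX ha hsm hax hDx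
    have hya0 : 0 < x / a := div_pos hx ha0
    have hyax : x / a ≤ x := div_le_self hx.le ha1
    have hyaY : x / Y ≤ x / a := div_le_div_of_nonneg_left hx.le ha0 haY
    have hle : Real.log (x / a) ≤ Real.log x := Real.log_le_log hya0 hyax
    have hge : 2 / 3 * Real.log x ≤ Real.log (x / a) := by
      have : Real.log (x / Y) = 2 / 3 * Real.log x := by
        rw [Real.log_div hx.ne' hY.ne', hlogY]; ring
      rw [← this]
      exact Real.log_le_log (div_pos hx hY) hyaY
    have hsq := sqrt_logFactor_le (f.natDegree ^ 2) hv hlogx hlogX hge hle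
    have hG0 : 0 ≤ Real.sqrt ((Int.gcd h a : ℝ) * a * polyRootCountMod ![f] a / φ a) :=
      Real.sqrt_nonneg _
    calc ∑ k ∈ (Icc 1 D).filter (fun k => smoothPart (⌊X⌋₊ + 1) k = a), ‖polyRootWeylSum f k h‖
        ≤ _ := hin
      _ ≤ C1 * (x / a) * (Real.sqrt (3 / 2) *
            (v ^ ((((f.natDegree ^ 2 : ℕ) : ℝ) + 1) / 2) / Real.log x)) *
            Real.sqrt ((Int.gcd h a : ℝ) * a * polyRootCountMod ![f] a / φ a) :=
          mul_le_mul_of_nonneg_right (mul_le_mul_of_nonneg_left hsq (by positivity)) hG0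
      _ = C1 * (Real.sqrt (3 / 2) * (v ^ ((((f.natDegree ^ 2 : ℕ) : ℝ) + 1) / 2) / Real.log x)) *
            (x / a * Real.sqrt ((Int.gcd h a : ℝ) * a * polyRootCountMod ![f] a / φ a)) := by ring
      _ = _ := by rw [div_mul_sqrt_eq ha0 hφ0]; ring
  · have hempty : (Icc 1 D).filter (fun k => smoothPart (⌊X⌋₊ + 1) k = a) = ∅ :=
      Finset.filter_eq_empty_iff.2 fun k _ hka => hsm (hka ▸ forall_primeFactors_smoothPart_le (by linarith) k)
    rw [hempty, Finset.sum_empty]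
    have : 0 ≤ v ^ ((((f.natDegree ^ 2 : ℕ) : ℝ) + 1) / 2) / Real.log x :=
      div_nonneg (Real.rpow_nonneg hv.le _) hlogx.le
    positivity

/-- `Σ₂` at Hooley's parameters: with `t = 3(A+2)`, `X = x^{1/v}` (`v = log log x`), `Y = x^{1/3}`,
`∑_{k ≤ D, k₁ > Y} |S(h,k)| ≤ C₂ x/(log x)²`. [folklore] -/
theorem sum_sigma2_le_at_parameters {f : ℤ[X]} {h : ℤ} {C2 t : ℝ} {A : ℕ} (hC2 : 0 ≤ C2)
    (h2 : ∀ (N : ℕ) (X Y : ℝ), 2 ≤ X → 3 * t ≤ Real.log X → 1 ≤ Y →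
      ∑ k ∈ (Icc 1 N).filter (fun k => Y < (smoothPart (⌊X⌋₊ + 1) k : ℝ)), ‖polyRootWeylSum f k h‖ ≤
        C2 * N * Y ^ (-(t / Real.log X)) * Real.log X ^ A)
    (ht : t = 3 * ((A : ℝ) + 2)) {X x Y v : ℝ} {D : ℕ} (hX2 : 2 ≤ X) (hMt : 3 * t ≤ Real.log X)
    (hY1 : 1 ≤ Y) (hxD : x = D) (hlogx : 0 < Real.log x) (hv : 0 < v)
    (hexpv : Real.exp v = Real.log x) (hlogX : Real.log X = Real.log x / v)
    (hlogXle : Real.log X ≤ Real.log x) (hlogY : Real.log Y = Real.log x / 3) :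
    ∑ k ∈ (Icc 1 D).filter (fun k => Y < (smoothPart (⌊X⌋₊ + 1) k : ℝ)), ‖polyRootWeylSum f k h‖ ≤
      C2 * (x / Real.log x ^ 2) := by
  have hY0 : 0 < Y := by linarith
  have hlogXpos : 0 < Real.log X := by rw [hlogX]; positivity
  have hvq : Real.log x / Real.log X = v := by rw [hlogX]; field_simp
  have hb := h2 D X Y hX2 hMt hY1
  have hYη : Y ^ (-(t / Real.log X)) = Real.exp (-(((A : ℝ) + 2) * v)) := by
    rw [Real.rpow_def_of_pos hY0, hlogY]
    congr 1
    rw [← hvq, ht]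
    field_simp
  have hpowA : Real.log X ^ A ≤ Real.exp ((A : ℝ) * v) := by
    calc Real.log X ^ A ≤ Real.log x ^ A := pow_le_pow_left₀ hlogXpos.le hlogXle A
      _ = Real.exp ((A : ℝ) * v) := by rw [Real.exp_nat_mul, hexpv]
  have hexp2 : Real.exp (-(((A : ℝ) + 2) * v)) * Real.exp ((A : ℝ) * v) = 1 / Real.log x ^ 2 := by
    rw [← Real.exp_add, show -(((A : ℝ) + 2) * v) + (A : ℝ) * v = -((2 : ℕ) * v) by push_cast; ring,
      Real.exp_neg, Real.exp_nat_mul, hexpv, one_div]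
  have hnn : 0 ≤ C2 * (D : ℝ) * Y ^ (-(t / Real.log X)) := by positivity
  calc ∑ k ∈ (Icc 1 D).filter (fun k => Y < (smoothPart (⌊X⌋₊ + 1) k : ℝ)), ‖polyRootWeylSum f k h‖
      ≤ C2 * D * Y ^ (-(t / Real.log X)) * Real.log X ^ A := hb
    _ ≤ C2 * D * Y ^ (-(t / Real.log X)) * Real.exp ((A : ℝ) * v) :=
        mul_le_mul_of_nonneg_left hpowA hnn
    _ = C2 * (x / Real.log x ^ 2) := by
        rw [hYη, mul_assoc (C2 * (D : ℝ)), hexp2, hxD]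
        ring

/-! ### Assembly: the main estimate -/

/-- **Hooley's estimate, summed in absolute value.**  For `f` irreducible of degree `n ≥ 2` and
`h ≠ 0` there is `C` with, for all large `D`,
`∑_{k ≤ D} |S_f(h, k)| ≤ C · D (log log D)^{(n²+1)/2} / (log D)^{δ_n}`.
Proof (Hooley 1964, as outlined in Martin–Sitar 2011, §3.2): with `x = D`, `v = log log x`,
`X = x^{1/v}`, split `k ≤ x` according to `k₁ ≤ x^{1/3}` (`Σ₁`) or not (`Σ₂`);
`Σ₂ ≤ C x/(log x)²` by `exists_sum_norm_polyRootWeylSum_smoothPart_gt_le` with `t = 3(A+2)`,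
and `Σ₁ ≤ C x v^{(n²+1)/2}/log x · ∑_{a ≤ x^{1/3}} G(a) ≤ C x v^{(n²+1)/2} (log x)^{−δ_n}` by
`exists_sum_fiber_norm_polyRootWeylSum_le` and `exists_sum_sqrt_gcd_rootCount_div_le`.
[cite: DartygeMartin2019, Lemma 5 (case k = 1)]; [cite: Hooley1964, Theorem (per MartinSitar2010 §3.2)] -/
theorem exists_eventually_sum_norm_polyRootWeylSum_le {f : ℤ[X]} (hirr : Irreducible f)
    (hn : 2 ≤ f.natDegree) {h : ℤ} (hh : h ≠ 0) :
    ∃ C : ℝ, 0 < C ∧ ∀ᶠ D : ℕ in atTop,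
      ∑ k ∈ Icc 1 D, ‖polyRootWeylSum f k h‖ ≤
        C * ((D : ℝ) * Real.log (Real.log D) ^ (((f.natDegree : ℝ) ^ 2 + 1) / 2) /
          Real.log D ^ hooleyDelta f.natDegree) := by
  classical
  have hdeg : 0 < f.natDegree := by omega
  have hδ0 : 0 < hooleyDelta f.natDegree := hooleyDelta_pos hn
  have hδ1 : hooleyDelta f.natDegree ≤ 1 := hooleyDelta_le_one _
  obtain ⟨A, hA⟩ := exists_sum_norm_polyRootWeylSum_smoothPart_gt_le hirr hdeg h
  obtain ⟨C2, hC2, h2⟩ := hA (3 * ((A : ℝ) + 2)) (by positivity)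
  obtain ⟨C1, hC1, h1⟩ := exists_sum_fiber_norm_polyRootWeylSum_le hirr hdeg h
  obtain ⟨CG, hCG, hG⟩ := exists_sum_sqrt_gcd_rootCount_div_le hirr hn hh
  refine ⟨C1 * CG * Real.sqrt (3 / 2) + C2, by positivity, ?_⟩
  have ev1 : ∀ᶠ D : ℕ in atTop, (9 : ℝ) ≤ Real.log (Real.log D) :=
    (Real.tendsto_log_atTop.comp (Real.tendsto_log_atTop.comp tendsto_natCast_atTop_atTop)
      ).eventually_ge_atTop 9
  have ev2 : ∀ᶠ D : ℕ in atTop,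
      max (Real.log 3) (3 * (3 * ((A : ℝ) + 2))) ≤ Real.log D / Real.log (Real.log D) :=
    (tendsto_log_div_loglog_atTop.comp tendsto_natCast_atTop_atTop).eventually_ge_atTop _
  have ev3 : ∀ᶠ D : ℕ in atTop, 1 ≤ D := eventually_ge_atTop 1
  filter_upwards [ev1, ev2, ev3] with D hv9 hM hD1
  -- notation for the parameters (plain `have`-introduced equalities, no `set`)
  obtain ⟨x, hxD⟩ : ∃ x : ℝ, x = D := ⟨_, rfl⟩
  obtain ⟨v, hv⟩ : ∃ v : ℝ, v = Real.log (Real.log x) := ⟨_, rfl⟩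
  obtain ⟨X, hXdef⟩ : ∃ X : ℝ, X = Real.exp (Real.log x / v) := ⟨_, rfl⟩
  obtain ⟨Y, hYdef⟩ : ∃ Y : ℝ, Y = x ^ ((1 : ℝ) / 3) := ⟨_, rfl⟩
  have hv9' : (9 : ℝ) ≤ v := by rw [hv, hxD]; exact hv9
  have hM' : max (Real.log 3) (3 * (3 * ((A : ℝ) + 2))) ≤ Real.log x / v := by
    rw [hv, hxD]; exact hM
  have hx1 : (1 : ℝ) ≤ x := by rw [hxD]; exact_mod_cast hD1
  have hxpos : 0 < x := by linarith
  have hlogx0 : 0 ≤ Real.log x := Real.log_nonneg hx1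
  have hlogx : Real.exp 9 ≤ Real.log x := by
    rcases hlogx0.eq_or_lt with h0 | hpos
    · exfalso
      have : v = 0 := by rw [hv, ← h0, Real.log_zero]
      linarith
    · rw [← Real.exp_log hpos, ← hv]
      exact Real.exp_le_exp.2 hv9'
  have h10 : (10 : ℝ) ≤ Real.log x := le_trans (by linarith [Real.add_one_le_exp (9 : ℝ)]) hlogx
  have hlogx1 : 1 ≤ Real.log x := by linarith
  have hlogxpos : 0 < Real.log x := by linarith
  have hv0 : 0 < v := by linarith
  have hv1 : 1 ≤ v := by linarith
  have hexpv : Real.exp v = Real.log x := by rw [hv, Real.exp_log hlogxpos]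
  have hlogX : Real.log X = Real.log x / v := by rw [hXdef, Real.log_exp]
  have hM3 : Real.log 3 ≤ Real.log x / v := le_trans (le_max_left _ _) hM'
  have hMt : 3 * (3 * ((A : ℝ) + 2)) ≤ Real.log X := by
    rw [hlogX]; exact le_trans (le_max_right _ _) hM'
  have hX3 : 3 ≤ X := by
    calc (3 : ℝ) = Real.exp (Real.log 3) := (Real.exp_log (by norm_num)).symm
      _ ≤ Real.exp (Real.log x / v) := Real.exp_le_exp.2 hM3
      _ = X := hXdef.symm
  have hX2 : 2 ≤ X := by linarith
  have hlogXpos : 0 < Real.log X := by rw [hlogX]; positivity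
  have hlogXle : Real.log X ≤ Real.log x := by
    rw [hlogX, div_le_iff₀ hv0]; nlinarith
  have hx8 : (8 : ℝ) ≤ x := by
    have hl8 : Real.log 8 ≤ 7 := by
      linarith [Real.log_le_sub_one_of_pos (show (0 : ℝ) < 8 by norm_num)]
    exact (Real.log_le_log_iff (by norm_num) hxpos).1 (by linarith)
  have hYpos : 0 < Y := by rw [hYdef]; exact Real.rpow_pos_of_pos hxpos _
  have hY2 : 2 ≤ Y := by
    have h82 : (8 : ℝ) ^ ((1 : ℝ) / 3) = 2 := by
      rw [show (8 : ℝ) = 2 ^ (3 : ℕ) by norm_num, ← Real.rpow_natCast,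
        ← Real.rpow_mul (by norm_num)]
      norm_num
    rw [← h82, hYdef]
    exact Real.rpow_le_rpow (by norm_num) hx8 (by norm_num)
  have hY1 : 1 ≤ Y := by linarith
  have hYx : Y ≤ x := by
    calc Y = x ^ ((1 : ℝ) / 3) := hYdef
      _ ≤ x ^ (1 : ℝ) := Real.rpow_le_rpow_of_exponent_le hx1 (by norm_num)
      _ = x := Real.rpow_one x
  have hfloorY : 2 ≤ ⌊Y⌋₊ := Nat.le_floor (by exact_mod_cast hY2)
  have hY3 : Y ^ 3 = x := by
    rw [hYdef, ← Real.rpow_natCast, ← Real.rpow_mul hxpos.le]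
    norm_num
  have hlogY : Real.log Y = Real.log x / 3 := by
    rw [hYdef, Real.log_rpow hxpos]; ring
  have hX3Y : X ^ 3 ≤ Y := by
    have e1 : X ^ 3 = Real.exp (3 * (Real.log x / v)) := by
      rw [hXdef, ← Real.exp_nat_mul]; norm_num
    have e2 : Y = Real.exp (Real.log x / 3) := by
      rw [hYdef, Real.rpow_def_of_pos hxpos]; ring_nf
    rw [e1, e2, Real.exp_le_exp]
    have : 3 * (Real.log x / v) = Real.log x * (3 / v) := by ring
    rw [this, div_eq_mul_one_div (Real.log x) 3]
    refine mul_le_mul_of_nonneg_left ?_ hlogx0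
    rw [div_le_div_iff₀ hv0 (by norm_num)]
    linarith
  have hDx : (D : ℝ) ≤ x := hxD.ge
  -- the splitting `Σ₁ + Σ₂`
  have hsplit : ∑ k ∈ Icc 1 D, ‖polyRootWeylSum f k h‖ =
      ∑ k ∈ (Icc 1 D).filter (fun k => (smoothPart (⌊X⌋₊ + 1) k : ℝ) ≤ Y), ‖polyRootWeylSum f k h‖ +
      ∑ k ∈ (Icc 1 D).filter (fun k => Y < (smoothPart (⌊X⌋₊ + 1) k : ℝ)), ‖polyRootWeylSum f k h‖ := by
    rw [← Finset.sum_filter_add_sum_filter_not (Icc 1 D) (fun k => (smoothPart (⌊X⌋₊ + 1) k : ℝ) ≤ Y)]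
    congr 2
    exact Finset.filter_congr fun k _ => not_le
  -- `Σ₂`
  have hS2 := sum_sigma2_le_at_parameters hC2.le h2 rfl hX2 hMt hY1 hxD hlogxpos hv0 hexpv hlogX
    hlogXle hlogY
  -- `Σ₁`
  have hmaps : ∀ k ∈ (Icc 1 D).filter (fun k => (smoothPart (⌊X⌋₊ + 1) k : ℝ) ≤ Y),
      smoothPart (⌊X⌋₊ + 1) k ∈ Icc 1 ⌊Y⌋₊ := by
    intro k hk
    rw [Finset.mem_filter] at hk
    rw [Finset.mem_Icc]
    exact ⟨Nat.pos_of_ne_zero (smoothPart_ne_zero (⌊X⌋₊ + 1) k), Nat.le_floor hk.2⟩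
  have hfib : ∀ a ∈ Icc 1 ⌊Y⌋₊,
      ∑ k ∈ ((Icc 1 D).filter (fun k => (smoothPart (⌊X⌋₊ + 1) k : ℝ) ≤ Y)).filter
          (fun k => smoothPart (⌊X⌋₊ + 1) k = a), ‖polyRootWeylSum f k h‖ ≤
        C1 * x * (Real.sqrt (3 / 2) *
          (v ^ ((((f.natDegree ^ 2 : ℕ) : ℝ) + 1) / 2) / Real.log x)) *
          Real.sqrt ((Int.gcd h a : ℝ) * polyRootCountMod ![f] a / ((a : ℝ) * φ a)) := by
    intro a ha
    rw [Finset.mem_Icc] at ha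
    have haY : (a : ℝ) ≤ Y := le_trans (by exact_mod_cast ha.2) (Nat.floor_le hYpos.le)
    refine le_trans (Finset.sum_le_sum_of_subset_of_nonneg
      (Finset.filter_subset_filter _ (Finset.filter_subset _ _)) fun _ _ _ => norm_nonneg _) ?_
    exact sum_fiber_le_at_parameters hC1.le h1 hX3 hxpos hlogxpos hv0 hlogX hYpos hlogY hX3Y hY3
      hDx ha.1 haY
  have hlogfl : 0 ≤ Real.log (⌊Y⌋₊ : ℝ) :=
    Real.log_nonneg (by exact_mod_cast (show 1 ≤ ⌊Y⌋₊ by omega))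
  have hlogfl' : Real.log (⌊Y⌋₊ : ℝ) ≤ Real.log x :=
    Real.log_le_log (by exact_mod_cast (show 0 < ⌊Y⌋₊ by omega)) ((Nat.floor_le hYpos.le).trans hYx)
  have hB0 : 0 ≤ C1 * x * (Real.sqrt (3 / 2) *
      (v ^ ((((f.natDegree ^ 2 : ℕ) : ℝ) + 1) / 2) / Real.log x)) := by
    have : 0 ≤ v ^ ((((f.natDegree ^ 2 : ℕ) : ℝ) + 1) / 2) / Real.log x :=
      div_nonneg (Real.rpow_nonneg hv0.le _) hlogx0
    positivity
  have hS1 : ∑ k ∈ (Icc 1 D).filter (fun k => (smoothPart (⌊X⌋₊ + 1) k : ℝ) ≤ Y), ‖polyRootWeylSum f k h‖ ≤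
      C1 * CG * Real.sqrt (3 / 2) *
        (x * v ^ ((((f.natDegree ^ 2 : ℕ) : ℝ) + 1) / 2) / Real.log x ^ hooleyDelta f.natDegree) := by
    calc ∑ k ∈ (Icc 1 D).filter (fun k => (smoothPart (⌊X⌋₊ + 1) k : ℝ) ≤ Y), ‖polyRootWeylSum f k h‖
        = ∑ a ∈ Icc 1 ⌊Y⌋₊, ∑ k ∈ ((Icc 1 D).filter (fun k => (smoothPart (⌊X⌋₊ + 1) k : ℝ) ≤ Y)).filter
            (fun k => smoothPart (⌊X⌋₊ + 1) k = a), ‖polyRootWeylSum f k h‖ :=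
          (Finset.sum_fiberwise_of_maps_to hmaps _).symm
      _ ≤ ∑ a ∈ Icc 1 ⌊Y⌋₊, C1 * x * (Real.sqrt (3 / 2) *
            (v ^ ((((f.natDegree ^ 2 : ℕ) : ℝ) + 1) / 2) / Real.log x)) *
            Real.sqrt ((Int.gcd h a : ℝ) * polyRootCountMod ![f] a / ((a : ℝ) * φ a)) :=
          Finset.sum_le_sum hfib
      _ = C1 * x * (Real.sqrt (3 / 2) *
            (v ^ ((((f.natDegree ^ 2 : ℕ) : ℝ) + 1) / 2) / Real.log x)) *
            ∑ a ∈ Icc 1 ⌊Y⌋₊,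
              Real.sqrt ((Int.gcd h a : ℝ) * polyRootCountMod ![f] a / ((a : ℝ) * φ a)) := by
          rw [Finset.mul_sum]
      _ ≤ C1 * x * (Real.sqrt (3 / 2) *
            (v ^ ((((f.natDegree ^ 2 : ℕ) : ℝ) + 1) / 2) / Real.log x)) *
            (CG * Real.log ⌊Y⌋₊ ^ (1 - hooleyDelta f.natDegree)) :=
          mul_le_mul_of_nonneg_left (hG ⌊Y⌋₊ hfloorY) hB0
      _ ≤ C1 * x * (Real.sqrt (3 / 2) *
            (v ^ ((((f.natDegree ^ 2 : ℕ) : ℝ) + 1) / 2) / Real.log x)) *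
            (CG * Real.log x ^ (1 - hooleyDelta f.natDegree)) :=
          mul_le_mul_of_nonneg_left (mul_le_mul_of_nonneg_left
            (Real.rpow_le_rpow hlogfl hlogfl' (by linarith)) hCG.le) hB0
      _ = C1 * CG * Real.sqrt (3 / 2) *
            (x * v ^ ((((f.natDegree ^ 2 : ℕ) : ℝ) + 1) / 2) /
              Real.log x ^ hooleyDelta f.natDegree) :=
          sigma1_identity hlogxpos
  -- total
  have hve : 1 ≤ v ^ ((((f.natDegree ^ 2 : ℕ) : ℝ) + 1) / 2) :=
    Real.one_le_rpow hv1 (by positivity)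
  have hcore := div_sq_le_mul_div_rpow hxpos.le hlogx1 hve (by linarith : hooleyDelta f.natDegree ≤ 2)
  have hcast : ((f.natDegree ^ 2 : ℕ) : ℝ) = (f.natDegree : ℝ) ^ 2 := by push_cast; ring
  rw [hsplit, ← hxD]
  rw [hcast] at hS1 hcore
  rw [← hv]
  calc _ ≤ C1 * CG * Real.sqrt (3 / 2) *
          (x * v ^ (((f.natDegree : ℝ) ^ 2 + 1) / 2) / Real.log x ^ hooleyDelta f.natDegree) +
          C2 * (x / Real.log x ^ 2) := add_le_add hS1 hS2
    _ ≤ C1 * CG * Real.sqrt (3 / 2) *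
          (x * v ^ (((f.natDegree : ℝ) ^ 2 + 1) / 2) / Real.log x ^ hooleyDelta f.natDegree) +
          C2 * (x * v ^ (((f.natDegree : ℝ) ^ 2 + 1) / 2) / Real.log x ^ hooleyDelta f.natDegree) :=
        add_le_add le_rfl (mul_le_mul_of_nonneg_left hcore hC2.le)
    _ = (C1 * CG * Real.sqrt (3 / 2) + C2) *
          (x * v ^ (((f.natDegree : ℝ) ^ 2 + 1) / 2) / Real.log x ^ hooleyDelta f.natDegree) := by
        ring

/-- **Hooley's theorem on the roots of a polynomial congruence with its logarithmic saving —
PROVED**: the named fact `hooley_polyRoots_logPowerSaving` (Hooley 1964, as printed in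
Dartyge–Martin 2019, Lemma 5, case `k = 1`) holds.  Discharges
`Literature.NumberTheory.Sieve.hooley_polyRoots_logPowerSaving` of `PolynomialCongruences.lean` (the qualitative fact
`hooley_polyRoots_equidistributed` follows by `hooley_polyRoots_logPowerSaving.equidistributed`;
its direct discharge is `hooley_polyRoots_equidistributed_holds` of
`PolynomialCongruencesProofs.lean`). [cite: DartygeMartin2019, Lemma 5 (case k = 1)] -/
theorem hooley_polyRoots_logPowerSaving_holds : hooley_polyRoots_logPowerSaving := by
  intro f hn hirr h hh
  obtain ⟨C, hC, hev⟩ := exists_eventually_sum_norm_polyRootWeylSum_le hirr hn hh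
  have hpos : ∀ᶠ D : ℕ in atTop, 0 ≤ (D : ℝ) * Real.log (Real.log D) ^ (((f.natDegree : ℝ) ^ 2 + 1) / 2) /
      Real.log D ^ hooleyDelta f.natDegree := by
    have e1 : ∀ᶠ D : ℕ in atTop, (0 : ℝ) ≤ Real.log (Real.log D) :=
      (Real.tendsto_log_atTop.comp (Real.tendsto_log_atTop.comp tendsto_natCast_atTop_atTop)
        ).eventually_ge_atTop 0
    have e2 : ∀ᶠ D : ℕ in atTop, (0 : ℝ) ≤ Real.log D :=
      (Real.tendsto_log_atTop.comp tendsto_natCast_atTop_atTop).eventually_ge_atTop 0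
    filter_upwards [e1, e2] with D h1 h2
    exact div_nonneg (mul_nonneg (Nat.cast_nonneg D) (Real.rpow_nonneg h1 _)) (Real.rpow_nonneg h2 _)
  refine IsBigO.of_bound C ?_
  filter_upwards [hev, hpos] with D hD hp
  rw [Real.norm_of_nonneg hp]
  exact (norm_sum_le _ _).trans hD

end Literature.NumberTheory.Sieve
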